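import Summits.KontsevichZagierPeriods.KontsevichZagierPeriods.Theses.LiftingCriteria
import Literature.Analysis.Complex.PuiseuxAtInfinityAtlas
import Literature.ModelTheory.ExponentialFields.SemialgebraicInterior
import Literature.NumberTheory.Transcendental.SemialgebraicMapsProofs
import Literature.NumberTheory.Transcendental.KZSemialgebraicComplex
import Literature.NumberTheory.Transcendental.EllIterRep

/-!
# `CubeNashNormalForm` (stmt-KontsevichZagierPeriods-3574): real Newton–Puiseux charts

Support file for the item `CubeNashNormalForm` of route `LiftingCriteria` (the ramified
substitutions `x = c + uᴺ` at the end points of one-dimensional cells). For a real function `f`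
whose graph over `(p, q)` is `ℚ`-semialgebraic, continuous and bounded there, `p` algebraic:

* §1 `exists_mvPolynomial_relation` — a `ℚ`-semialgebraic function of one variable satisfies a
  non-trivial polynomial relation `P(x, f x) = 0`, `0 ≠ P ∈ ℚ[X, Y]` (its graph has empty
  interior, hence lies in finitely many proper zero sets);
* §2 `exists_atlas_real` — after `w = (x − p)⁻¹` the complex Puiseux atlas at infinity
  (`Literature.Analysis.Complex.PuiseuxInfinity.exists_branch_atlas`) puts every value
  `f (p + sᵉ)`, `s > 0` small, on one of finitely many Laurent–Puiseux branches `y(s)/s^M`;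
* (sequel `LiftingCriteriaCubeNashNormalFormPuiseuxChart.lean`) the real Puiseux chart
  `f (p + sᵉ) = G s`, `G` analytic at `0`.

Classical statement: a continuous bounded semialgebraic (Nash) function on `(p, q)` has a
convergent Puiseux expansion `∑ aₖ (x − p)^{k/e}` at `p⁺` [Bochnak–Coste–Roy 1998, Prop. 8.1.13;
Brieskorn–Knörrer 1986, §8.3]. PROVED here, no definition, no named fact.
-/

noncomputable section

open Set Filter Topology Metric
open scoped Polynomial
open Literature.ModelTheory.ExponentialFields (IsSemialgebraic)
open Literature.NumberTheory.Transcendental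

namespace Summit.KontsevichZagierPeriods.LiftingCriteria.CubeNashNormalFormPuiseux

/-! ## §1 A semialgebraic function of one variable satisfies a polynomial relation -/

/-- **Polynomial relation.** If `f : ℝ¹ → ℝ` is `ℚ`-semialgebraic on `S ⊆ ℝ¹` then there is a
non-zero `P ∈ ℚ[X₀, X₁]` with `P(x, f x) = 0` for all `x ∈ S`: the graph of `f` over `S` is a
`ℚ`-semialgebraic subset of `ℝ²` with empty interior, hence contained in the union of finitely many
zero sets of non-trivial polynomials (`IsSemialgebraic.subset_interior_union`); take their product.
[Bochnak–Coste–Roy 1998, §2.8 / Prop. 8.1.13] [folklore] -/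
theorem exists_mvPolynomial_relation {S : Set (Fin 1 → ℝ)} {f : (Fin 1 → ℝ) → ℝ}
    (hf : IsSemialgebraicFunOn ℚ S f) :
    ∃ P : MvPolynomial (Fin (1 + 1)) ℚ, P ≠ 0 ∧
      ∀ x ∈ S, MvPolynomial.aeval (Fin.snoc x (f x) : Fin (1 + 1) → ℝ) P = 0 := by
  classical
  set G : Set (Fin (1 + 1) → ℝ) := {z | ∃ x ∈ S, z = Fin.snoc x (f x)} with hG_def
  have hG : IsSemialgebraic ℚ G := hf
  -- the graph has empty interior
  have hint : interior G = ∅ := by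
    refine Set.eq_empty_iff_forall_notMem.mpr fun z hz => ?_
    obtain ⟨ε, hε, hball⟩ := Metric.mem_nhds_iff.mp (mem_interior_iff_mem_nhds.mp hz)
    obtain ⟨x, -, hzx⟩ := interior_subset hz
    set z' : Fin (1 + 1) → ℝ := Function.update z (Fin.last 1) (z (Fin.last 1) + ε / 2) with hz'
    have hz'ball : z' ∈ Metric.ball z ε := by
      rw [Metric.mem_ball, dist_pi_lt_iff hε]
      intro b
      by_cases hb : b = Fin.last 1
      · subst hb
        rw [hz', Function.update_self, Real.dist_eq, show z (Fin.last 1) + ε / 2 - z (Fin.last 1) = ε / 2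
          by ring, abs_of_pos (by linarith)]
        linarith
      · rw [hz', Function.update_of_ne hb, dist_self]
        exact hε
    obtain ⟨x', -, hz'x⟩ := hball hz'ball
    have h1 : Fin.init z' = Fin.init z := by
      rw [hz']
      exact Fin.init_update_last _ _
    have hx : Fin.init z = x := by rw [hzx, Fin.init_snoc]
    have hx' : Fin.init z' = x' := by rw [hz'x, Fin.init_snoc]
    have hxx' : x' = x := by rw [← hx', h1, hx]
    have hlast : z' (Fin.last 1) = z (Fin.last 1) := by
      rw [hz'x, hzx, Fin.snoc_last, Fin.snoc_last, hxx']
    rw [hz', Function.update_self] at hlast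
    linarith
  obtain ⟨Q₀, hQ₀, hsub⟩ := hG.subset_interior_union
  rw [hint, empty_union] at hsub
  refine ⟨∏ q ∈ Q₀, q, Finset.prod_ne_zero_iff.mpr fun q hq h0 => ?_, fun x hx => ?_⟩
  · obtain ⟨y, hy⟩ := hQ₀ q hq
    exact hy (by rw [h0, map_zero])
  · have hz : (Fin.snoc x (f x) : Fin (1 + 1) → ℝ) ∈ G := ⟨x, hx, rfl⟩
    obtain ⟨q, hq, hq0⟩ : ∃ q ∈ Q₀, MvPolynomial.aeval (Fin.snoc x (f x) : Fin (1 + 1) → ℝ) q = 0 := by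
      simpa only [mem_iUnion, mem_setOf_eq, exists_prop] using hsub hz
    rw [map_prod]
    exact Finset.prod_eq_zero hq hq0

/-! ## §2 The complex Puiseux atlas along the positive reals -/

/-- The vector `(w, y) ∈ ℝ²` in `Fin.snoc` form. [folklore] -/
theorem snoc_eq_vec (w y : ℝ) : (Fin.snoc (fun _ : Fin 1 => w) y : Fin (1 + 1) → ℝ) = ![w, y] := by
  ext i
  refine Fin.lastCases ?_ (fun j => ?_) i
  · rw [Fin.snoc_last]
    rfl
  · have hj : j = 0 := Subsingleton.elim _ _
    subst hj
    rw [Fin.snoc_castSucc]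
    rfl

/-- Evaluation of the complexified relation at real points. [folklore] -/
theorem eval_map_ofReal (P : MvPolynomial (Fin (1 + 1)) ℚ) (x y : ℝ) :
    MvPolynomial.eval ![(x : ℂ), (y : ℂ)] (MvPolynomial.map (algebraMap ℚ ℂ) P) =
      ((MvPolynomial.aeval ![x, y] P : ℝ) : ℂ) := by
  have h1 : ((MvPolynomial.aeval ![x, y] P : ℝ) : ℂ) =
      Complex.ofRealHom (MvPolynomial.eval₂ (algebraMap ℚ ℝ) ![x, y] P) := rfl
  rw [MvPolynomial.eval_map, h1, MvPolynomial.eval₂_comp_left]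
  have h2 : Complex.ofRealHom.comp (algebraMap ℚ ℝ) = algebraMap ℚ ℂ :=
    RingHom.ext fun r => by simp
  have h3 : (Complex.ofRealHom ∘ ![x, y] : Fin (1 + 1) → ℂ) = ![(x : ℂ), (y : ℂ)] := by
    funext i
    fin_cases i <;> rfl
  rw [h2, h3]

/-- Precomposition with `w ↦ p + w⁻¹` (`p` algebraic, `W` algebraic with `0 < W`,
`W⁻¹ ≤ q − p`): if the graph of `f` over `(p, q)` is `ℚ`-semialgebraic then so is the graph of
`w ↦ f (p + w⁻¹)` over `(W, ∞)` (composition with a `ℚ`-semialgebraic map, Tarski–Seidenberg).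
[folklore] -/
theorem isSemialgebraicFunOn_comp_inv {f : ℝ → ℝ} {p q W : ℝ} (hp : IsAlgebraic ℚ p)
    (hW : IsAlgebraic ℚ W) (hW0 : 0 < W) (hWq : W⁻¹ ≤ q - p)
    (hf : IsSemialgebraicFunOn ℚ {t : Fin 1 → ℝ | t 0 ∈ Ioo p q} (fun t => f (t 0))) :
    IsSemialgebraicFunOn ℚ {t : Fin 1 → ℝ | W < t 0} (fun t => f (p + (t 0)⁻¹)) := by
  have hT : IsSemialgebraic ℚ {t : Fin 1 → ℝ | W < t 0} := KZ.isSemialgebraic_setOf_const_lt_apply hW 0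
  have hpos : ∀ t ∈ {t : Fin 1 → ℝ | W < t 0}, 0 < t 0 := fun t ht => hW0.trans ht
  have hinv : IsSemialgebraicFunOn ℚ {t : Fin 1 → ℝ | W < t 0} (fun t => (t 0)⁻¹) := by
    refine (isSemialgebraicFunOn_aeval_div_aeval hT (1 : MvPolynomial (Fin 1) ℚ) (MvPolynomial.X 0)
      fun t ht => ?_).congr fun t _ => ?_
    · simpa using (hpos t ht).ne'
    · simp
  have hcoord : IsSemialgebraicFunOn ℚ {t : Fin 1 → ℝ | W < t 0} (fun t => p + (t 0)⁻¹) :=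
    IsSemialgebraicFunOn.add_holds (isSemialgebraicFunOn_const_of_isAlgebraic hT hp) hinv
  have hΦ : IsSemialgebraicMapOn ℚ {t : Fin 1 → ℝ | W < t 0}
      (fun t => fun _ : Fin 1 => p + (t 0)⁻¹) := IsSemialgebraicMapOn.of_forall hT fun _ => hcoord
  have hmaps : MapsTo (fun t : Fin 1 → ℝ => fun _ : Fin 1 => p + (t 0)⁻¹) {t | W < t 0}
      {t : Fin 1 → ℝ | t 0 ∈ Ioo p q} := by
    intro t ht
    have ht0 : 0 < t 0 := hpos t ht
    have h1 : (t 0)⁻¹ < W⁻¹ := (inv_lt_inv₀ ht0 hW0).2 ht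
    refine ⟨lt_add_of_pos_right p (inv_pos.2 ht0), ?_⟩
    show p + (t 0)⁻¹ < q
    linarith
  exact IsSemialgebraicFunOn.comp_isSemialgebraicMapOn_holds hf hΦ hmaps

/-- **The atlas along the positive reals.** For `f` with `ℚ`-semialgebraic graph over `(p, q)`,
`p` algebraic: there are `e ≥ 1`, `r > 0`, `ρ > 0` and a finite set `B` of pairs `(y, M)`, `y`
holomorphic on `|t| < r`, such that for `0 < s < ρ` the point `p + sᵉ` lies in `(p, q)`, `s < r`,
and `f (p + sᵉ) = y(s)/s^M` for some `(y, M) ∈ B` (the complex Puiseux atlas at infinity of a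
polynomial relation for `w ↦ f (p + w⁻¹)`, read at `w = s⁻ᵉ`, `t = s`). [folklore] -/
theorem exists_atlas_real {f : ℝ → ℝ} {p q : ℝ} (hpq : p < q) (hp : IsAlgebraic ℚ p)
    (hf : IsSemialgebraicFunOn ℚ {t : Fin 1 → ℝ | t 0 ∈ Ioo p q} (fun t => f (t 0))) :
    ∃ (e : ℕ) (_ : 0 < e) (r : ℝ) (_ : 0 < r) (ρ : ℝ) (_ : 0 < ρ) (B : Finset ((ℂ → ℂ) × ℕ)),
      (∀ b ∈ B, DifferentiableOn ℂ b.1 (ball 0 r)) ∧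
      ∀ s ∈ Ioo (0:ℝ) ρ, p + s ^ e ∈ Ioo p q ∧ s < r ∧
        ∃ b ∈ B, ((f (p + s ^ e) : ℝ) : ℂ) = b.1 s / (s : ℂ) ^ b.2 := by
  classical
  -- a rational threshold `W = N + 1` with `W⁻¹ ≤ q - p`
  obtain ⟨N, hN⟩ := exists_nat_one_div_lt (sub_pos.mpr hpq)
  set W : ℝ := (N : ℝ) + 1 with hW_def
  have hW0 : 0 < W := by positivity
  have hWq : W⁻¹ ≤ q - p := by rw [inv_eq_one_div]; exact hN.le
  have hWalg : IsAlgebraic ℚ W := by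
    have := isAlgebraic_algebraMap (R := ℚ) (A := ℝ) ((N : ℚ) + 1)
    simpa [hW_def] using this
  -- the relation for `w ↦ f (p + w⁻¹)` and its complexification
  obtain ⟨P, hP0, hP⟩ := exists_mvPolynomial_relation (isSemialgebraicFunOn_comp_inv hp hWalg hW0 hWq hf)
  set Pc : MvPolynomial (Fin (1 + 1)) ℂ := MvPolynomial.map (algebraMap ℚ ℂ) P with hPc
  have hPc0 : Pc ≠ 0 := fun h => hP0 (MvPolynomial.map_injective _ (algebraMap ℚ ℂ).injective
    (by rw [map_zero]; exact h))
  have hrel : ∀ w : ℝ, W < w →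
      MvPolynomial.eval ![(w : ℂ), ((f (p + w⁻¹) : ℝ) : ℂ)] Pc = 0 := by
    intro w hw
    have h := hP (fun _ : Fin 1 => w) hw
    rw [snoc_eq_vec] at h
    rw [hPc, eval_map_ofReal, h, Complex.ofReal_zero]
  -- the atlas
  obtain ⟨e, he, R, r, hr, -, B, hB, hat⟩ :=
    Literature.Analysis.Complex.PuiseuxInfinity.exists_branch_atlas Pc hPc0
  set K : ℝ := max W (max R 1) with hK
  have hK1 : 1 ≤ K := (le_max_right _ _).trans (le_max_right _ _)
  have hK0 : 0 < K := one_pos.trans_le hK1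
  refine ⟨e, he, r, hr, K⁻¹, inv_pos.2 hK0, B, hB, fun s hs => ?_⟩
  have hs0 : 0 < s := hs.1
  have hρ1 : K⁻¹ ≤ 1 := inv_le_one_of_one_le₀ hK1
  have hs1 : s < 1 := hs.2.trans_le hρ1
  have hse0 : 0 < s ^ e := pow_pos hs0 e
  have hse : s ^ e ≤ s := pow_le_of_le_one hs0.le hs1.le he.ne'
  have hseK : s ^ e < K⁻¹ := hse.trans_lt hs.2
  set w : ℝ := (s ^ e)⁻¹ with hw
  have hKw : K < w := by
    have := (inv_lt_inv₀ (inv_pos.2 hK0) hse0).2 hseK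
    rwa [inv_inv] at this
  have hWw : W < w := (le_max_left _ _).trans_lt hKw
  have hRw : R < w := ((le_max_left _ _).trans (le_max_right _ _)).trans_lt hKw
  have hw0 : 0 < w := hK0.trans hKw
  have hwinv : w⁻¹ = s ^ e := by rw [hw, inv_inv]
  have hmem : p + s ^ e ∈ Ioo p q := by
    refine ⟨lt_add_of_pos_right p hse0, ?_⟩
    have h1 : w⁻¹ < W⁻¹ := (inv_lt_inv₀ hw0 hW0).2 hWw
    rw [hwinv] at h1
    linarith
  -- apply the atlas at `u = w`, `v = f (p + s ^ e)`, `t = s`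
  have hnorm : R < ‖(w : ℂ)‖ := by
    rw [Complex.norm_real, Real.norm_eq_abs, abs_of_pos hw0]
    exact hRw
  have heval : MvPolynomial.eval ![(w : ℂ), ((f (p + s ^ e) : ℝ) : ℂ)] Pc = 0 := by
    have := hrel w hWw
    rwa [hwinv] at this
  have ht : (s : ℂ) ^ e = (w : ℂ)⁻¹ := by
    rw [hw]
    push_cast
    rw [inv_inv]
  obtain ⟨-, hsr, b, hb, hv⟩ := hat (w : ℂ) _ hnorm heval (s : ℂ) ht
  have hsr' : s < r := by
    rw [Complex.norm_real, Real.norm_eq_abs, abs_of_pos hs0] at hsr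
    exact hsr
  exact ⟨hmem, hsr', b, hb, hv⟩

end Summit.KontsevichZagierPeriods.LiftingCriteria.CubeNashNormalFormPuiseux
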